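import Summits.CriticalPhenomena.PercolationContinuityZ3.Theorems.PercNearOneGluingNoHeavyLowerTailMajorityGluingQCertSym3Parts
import HarnessLib

/-!
# Fast cubic orbit keys I: table popcounts and numbers from bit lists (lane prim-rate, constants-miner 1, gen 37; NEXT-g37 item 4)

Support file for the closed crux `NoHeavyLowerTail` (stmt-CriticalPhenomena-4575), majority-gluing line.  The kernel cost of a symmetrised degree-3
certificate (`…MajorityGluingQCertSym3`) is dominated by the orbit key `keyS3` of each contribution (`orient3` + `classList3` + three `pull`s by
list walks: ≈ 18 ms per key at `m = 10`).  This file and `…QCertSym3Blocks` / `…QCertSym3Fast` compute the SAME key arithmetically.  Here: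
popcounts of the low `m ≤ 16` bits by an 8-bit table (`pc8`, `pcT`, **`popcT_eq : popcT = popc`**), the number `ofBits l` with a given bit list,
`code = ofBits ∘ map` (`code_eq_ofBits`) and **`pull_getD_eq_ofBits`**: `pull` along a list relabelling is `ofBits` of the membership bits read
in list order.  Pure list / `Nat` arithmetic; no sorries.
-/

namespace Summit.CriticalPhenomena.PercolationContinuityZ3.Theorems

namespace HubOnly
namespace QCert

/-! ### Popcount by table -/

/-- The 8-bit popcount table, four bits per entry: `Σ_{b<256} popcount(b)·16^b`. -/
def pc8tab : ℕ := 95125173855764218123276304889944061997689682402263585766959741291920687686033329201817409157123347502415384089435969498586180241031507595463600295898153685276653211633572815512294064538494957912327413386667662218713394765509704508661031522276467630197481635010039778342554499416459730172574551513689147646224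

/-- Popcount of a byte by table lookup. -/
def pc8 (b : ℕ) : ℕ := Nat.land (Nat.shiftRight pc8tab (4 * b)) 15

/-- The table is the popcount of every byte. -/
theorem pc8_eq : ∀ b < 256, pc8 b = popc 8 b := by decide +kernel

/-- Popcount of the low 16 bits by two table lookups. -/
def pcT (K : ℕ) : ℕ := pc8 (Nat.land K 255) + pc8 (Nat.land (Nat.shiftRight K 8) 255)

/-- `popc` over one more bit. -/
theorem popc_succ (m K : ℕ) : popc (m + 1) K = popc m K + (if tb K m then 1 else 0) := by
  unfold popc
  rw [List.range_succ, List.filter_append, List.length_append]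
  by_cases h : tb K m = true
  · simp [h]
  · simp [h]

/-- `popc` splits over a sum of widths: the high part reads the shifted number. -/
theorem popc_add (a b K : ℕ) : popc (a + b) K = popc a K + popc b (K >>> a) := by
  induction b with
  | zero => simp [popc]
  | succ b ih =>
    rw [← Nat.add_assoc, popc_succ, ih, popc_succ, Nat.add_assoc]
    congr 2
    rw [tb_eq, tb_eq, Nat.testBit_shiftRight]

/-- `popc m 0 = 0`. -/
theorem popc_zero_right (m : ℕ) : popc m 0 = 0 := by
  unfold popc
  rw [List.length_eq_zero_iff, List.filter_eq_nil_iff]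
  intro x _
  simp [tb_eq]

/-- `popc a` only reads the low `a` bits. -/
theorem popc_land_mask (a K : ℕ) : popc a (Nat.land K (2 ^ a - 1)) = popc a K := by
  unfold popc
  congr 1
  refine List.filter_congr fun x hx => ?_
  rw [List.mem_range] at hx
  rw [tb_eq, tb_eq, show Nat.land K (2 ^ a - 1) = K &&& (2 ^ a - 1) from rfl, Nat.testBit_and, Nat.testBit_two_pow_sub_one]
  simp [hx]

/-- The two-byte table popcount is the popcount of the low 16 bits. -/
theorem pcT_eq (K : ℕ) : pcT K = popc 16 K := by
  have h1 : Nat.land K 255 < 256 := Nat.and_lt_two_pow K (by norm_num : 255 < 2 ^ 8)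
  have h2 : Nat.land (Nat.shiftRight K 8) 255 < 256 := Nat.and_lt_two_pow _ (by norm_num : 255 < 2 ^ 8)
  unfold pcT
  rw [pc8_eq _ h1, pc8_eq _ h2, show (255 : ℕ) = 2 ^ 8 - 1 by norm_num, popc_land_mask, popc_land_mask,
    show (16 : ℕ) = 8 + 8 by norm_num, popc_add]
  rfl

/-- **Fast popcount of the low `m` bits** (table path for `m ≤ 16`, `K < 2^m`; the definition `popc` otherwise). -/
def popcT (m K : ℕ) : ℕ := if m ≤ 16 ∧ K < 2 ^ m then pcT K else popc m K

/-- `popcT = popc`. -/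
theorem popcT_eq (m K : ℕ) : popcT m K = popc m K := by
  unfold popcT
  split_ifs with h
  · rw [pcT_eq]
    have e : (16 : ℕ) = m + (16 - m) := by omega
    rw [e, popc_add]
    have hz : K >>> m = 0 := by rw [Nat.shiftRight_eq_div_pow]; exact Nat.div_eq_of_lt h.2
    rw [hz, popc_zero_right, Nat.add_zero]
  · rfl

/-! ### Numbers from bit lists -/

/-- The number with binary digits `l` (least significant first). -/
def ofBits : List Bool → ℕ
  | [] => 0
  | b :: l => cond b 1 0 + 2 * ofBits l

/-- `ofBits` of a concatenation. -/
theorem ofBits_append (X Y : List Bool) : ofBits (X ++ Y) = ofBits X + 2 ^ X.length * ofBits Y := by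
  induction X with
  | nil => simp [ofBits]
  | cons b X ih => rw [List.cons_append, ofBits, ofBits, ih, List.length_cons, pow_succ]; ring

/-- `ofBits` of a block of ones. -/
theorem ofBits_replicate_true (n : ℕ) : ofBits (List.replicate n true) = 2 ^ n - 1 := by
  induction n with
  | zero => rfl
  | succ n ih =>
    rw [List.replicate_succ, ofBits, ih, cond_true, pow_succ]
    have : 1 ≤ 2 ^ n := Nat.one_le_two_pow
    omega

/-- `ofBits` of a block of zeros. -/
theorem ofBits_replicate_false (n : ℕ) : ofBits (List.replicate n false) = 0 := by
  induction n with
  | zero => rfl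
  | succ n ih => rw [List.replicate_succ, ofBits, ih, cond_false]

/-- `code` is `ofBits` of the sampled bit list. -/
theorem code_eq_ofBits : ∀ (m : ℕ) (f : ℕ → Bool), code m f = ofBits ((List.range m).map f)
  | 0, _ => rfl
  | m + 1, f => by
    rw [code, List.range_succ_eq_map, List.map_cons, List.map_map, ofBits, code_eq_ofBits m]
    rfl

/-- Sampling a list of length `n` at the positions `0 … n−1`. -/
theorem map_getD_range (L : List ℕ) (g : ℕ → Bool) : (List.range L.length).map (fun p => g (L.getD p p)) = L.map g := by
  refine List.ext_getElem (by simp) fun p h1 h2 => ?_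
  rw [List.length_map, List.length_range] at h1
  rw [List.getElem_map, List.getElem_map, List.getElem_range, List.getD_eq_getElem _ _ h1]

/-- **`pull` along a list relabelling is `ofBits` of the membership bits read in list order** (`K < 2^m`, list of length `m`). -/
theorem pull_getD_eq_ofBits (m : ℕ) (L : List ℕ) (hL : L.length = m) {K : ℕ} (hK : K < 2 ^ m) :
    pull m (fun p => L.getD p p) K = ofBits (L.map fun x => tb K x) := by
  unfold pull
  rw [if_pos hK, code_eq_ofBits, ← hL, map_getD_range]


end QCert
end HubOnly

end Summit.CriticalPhenomena.PercolationContinuityZ3.Theorems
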